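import Summits.CriticalPhenomena.PercolationContinuityZ3.Theorems.PercAnnulusCrossingIICRootBias
import Summits.CriticalPhenomena.PercolationContinuityZ3.Theorems.PercAnnulusCrossingIICLocalLimitShift
import Literature.Probability.Percolation.CriticalContinuityProofs
import HarnessLib

/-!
# Kesten's IIC is not translation invariant (lane RSW3, p1 gen 8)

builds on p205010 (kernel theorem, internal audit signed; external expert review pending) — used: the IIC at `p_c` and the mixing theorem of
p1 gen 7 live at `p = p_c(ℤ^d)` where `θ(p_c) = 0` enters the exhaustion-independence input of `…IICLocalLimitShift`.

RSW3 lane (LANE 3 `prim-rsw3`), seat `prim-rsw3-p1` (gen 8).  Helper file (`--supports stmt-CriticalPhenomena-4575`); no definitions, no sorries.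
Two kernel facts are combined: the ROOT BIAS `p_c < ν(s(0,y₀) open)` (`…IICRootBias`, under (A2)□) and the MIXING `ν({ω | ω + v ∈ E}) → P_{p_c}(E)`
as `v → ∞` (`…IICLocalLimitShift`, under (A2)□ at `p_c`).  With `E = {s(0,y₀) open}`, `P_{p_c}(E) = p_c`:

* **`iicMeasure_eventually_real_preimage_shift_lt`** — for all but finitely many `v ∈ ℤ^d`: `ν({ω | ω + v ∈ E}) < ν(E)`;
* **`iicMeasure_exists_real_preimage_shift_ne`** — hence `∃ v, ν({ω | ω + v ∈ E}) ≠ ν(E)`: KESTEN'S IIC MEASURE IS NOT TRANSLATION INVARIANT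
  (at `p_c(ℤ^d)`, `d ≥ 2`, under (A2)□ at aspect `(s,L)`, `2 ≤ s ≤ L`; every IIC probability measure).
References: H. Kesten, PTRF 73 (1986) Thm (3), (1.12)–(1.13); D. Basu, A. Sapozhnikov, ECP 22 (2017) no. 26, Thm 1.1.
-/

noncomputable section

namespace Summit.CriticalPhenomena.PercolationContinuityZ3.Theorems.Crossing

open MeasureTheory Filter Topology Literature.Probability.Percolation Literature.Probability.LatticeModels
open Literature.Probability.Percolation.DCT16

variable {d : ℕ}

/-- **Far translates of the root-edge event have strictly smaller IIC probability**: at `p_c(ℤ^d)`, `d ≥ 2`, under (A2)□ at aspect `(s,L)`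
(`2 ≤ s ≤ L`, `ϰ > 0`), for every IIC probability measure `ν` and every neighbour `y₀` of `0`: for all but finitely many `v`,
`ν({ω | ω + v ∈ {s(0,y₀) open}}) < ν(s(0,y₀) open)` (the left side tends to `p_c`, the right side exceeds `p_c`).
[cite: Kesten1986, Thm. (3), (1.12)–(1.13)] [cite: BasuSapozhnikov2017ECP, Thm. 1.1] -/
theorem iicMeasure_eventually_real_preimage_shift_lt (hd : 2 ≤ d) {s L : ℕ} (hs : 2 ≤ s) (hsL : s ≤ L) {ϰ : ℝ} (hϰ : 0 < ϰ)
    (hA2 : SetToSetQuasiMultAspectAt d (criticalProbI d) s L ϰ) {ν : Measure (BondConfig (Site d))} [IsProbabilityMeasure ν]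
    (hν : ∀ (F : Finset (Sym2 (Site d))) (E : Set (BondConfig (Site d))), MeasurableSet E → DeterminedBy E ↑F →
      Tendsto (fun n : ℕ => (bondPercolation (zdGraph d) (criticalProbI d)).real (E ∩ siteToBoundary d n) /
        oneArmProb d (criticalProbI d) n) atTop (𝓝 (ν.real E)))
    {y₀ : Site d} (hy₀ : (zdGraph d).Adj 0 y₀) :
    ∀ᶠ v : Site d in cofinite, ν.real (BondConfig.relabel (sym2Equiv (Site.shift v)) ⁻¹' {ω : BondConfig (Site d) | s((0 : Site d), y₀) ∈ ω}) <
      ν.real {ω : BondConfig (Site d) | s((0 : Site d), y₀) ∈ ω} := by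
  have hpc0 : 0 < ((criticalProbI d : unitInterval) : ℝ) := by rw [coe_criticalProbI]; exact criticalProb_zd_pos d (by omega)
  have hpc1 : ((criticalProbI d : unitInterval) : ℝ) < 1 := by rw [coe_criticalProbI]; exact criticalProb_zd_lt_one hd
  have hdet : DeterminedBy {ω : BondConfig (Site d) | s((0 : Site d), y₀) ∈ ω} (↑({s((0 : Site d), y₀)} : Finset (Sym2 (Site d))) : Set (Sym2 (Site d))) := by
    rw [determinedBy_iff]; intro ω ω' h
    have := (Set.ext_iff.1 h) s((0 : Site d), y₀)
    simp only [Set.mem_inter_iff, Finset.coe_singleton, Set.mem_singleton_iff, and_true] at this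
    exact this
  have hlim := iicMeasure_tendsto_real_preimage_shift_criticalProbI hd hs hsL hϰ hA2 hν hdet
  rw [bondPercolation_cylinder (zdGraph d) (criticalProbI d) ((SimpleGraph.mem_edgeSet _).2 hy₀)] at hlim
  have hgt := iicMeasure_real_edgeAtOrigin_gt (by omega) (criticalProbI d) hpc0 hpc1 (by omega : 1 ≤ s) hϰ hA2 hν hy₀
  exact hlim.eventually (gt_mem_nhds hgt)

/-- **KESTEN'S IIC IS NOT TRANSLATION INVARIANT**: at `p_c(ℤ^d)`, `d ≥ 2`, under (A2)□ at aspect `(s,L)` (`2 ≤ s ≤ L`, `ϰ > 0`), for every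
IIC probability measure `ν` there is a vertex `v` with `ν({ω | ω + v ∈ E}) ≠ ν(E)` for the cylinder `E = {s(0,y₀) open}` (any neighbour `y₀`
of `0`). [cite: Kesten1986, Thm. (3)] [cite: BasuSapozhnikov2017ECP, Thm. 1.1] -/
theorem iicMeasure_exists_real_preimage_shift_ne (hd : 2 ≤ d) {s L : ℕ} (hs : 2 ≤ s) (hsL : s ≤ L) {ϰ : ℝ} (hϰ : 0 < ϰ)
    (hA2 : SetToSetQuasiMultAspectAt d (criticalProbI d) s L ϰ) {ν : Measure (BondConfig (Site d))} [IsProbabilityMeasure ν]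
    (hν : ∀ (F : Finset (Sym2 (Site d))) (E : Set (BondConfig (Site d))), MeasurableSet E → DeterminedBy E ↑F →
      Tendsto (fun n : ℕ => (bondPercolation (zdGraph d) (criticalProbI d)).real (E ∩ siteToBoundary d n) /
        oneArmProb d (criticalProbI d) n) atTop (𝓝 (ν.real E)))
    {y₀ : Site d} (hy₀ : (zdGraph d).Adj 0 y₀) :
    ∃ v : Site d, ν.real (BondConfig.relabel (sym2Equiv (Site.shift v)) ⁻¹' {ω : BondConfig (Site d) | s((0 : Site d), y₀) ∈ ω}) ≠
      ν.real {ω : BondConfig (Site d) | s((0 : Site d), y₀) ∈ ω} := by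
  haveI : Nonempty (Fin d) := ⟨⟨0, by omega⟩⟩
  haveI : Infinite (Site d) := Pi.infinite_of_right
  obtain ⟨v, hv⟩ := (iicMeasure_eventually_real_preimage_shift_lt hd hs hsL hϰ hA2 hν hy₀).exists
  exact ⟨v, hv.ne⟩

end Summit.CriticalPhenomena.PercolationContinuityZ3.Theorems.Crossing
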